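import Summits.HubbardSuperconductivity.HubbardSuperconductivity.Theorems.BalabanIRBirGroundStateAverageLRO
import Summits.HubbardSuperconductivity.HubbardSuperconductivity.Theorems.NoGoNogoThesis
import Summits.HubbardSuperconductivity.HubbardSuperconductivity.Theorems.EnslavedA1gTorusNormalForms
import Literature.MathematicalPhysics.QuantumLattice.PairCorrelationsProofs

/-!
# Route `BalabanIR`, target `BirGroundStateAverageLRO` (item `stmt-HubbardSuperconductivity-2079`): a-priori bounds and the ∃-sequence shadow of the target

Complement to `BalabanIRBirGroundStateAverageLRO.lean` (skeleton, `tr P = dim E₀`, every ⇒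
average ⇒ some ground state, non-vacuity `re tr P ≥ 1`). The target asks, on an open window of
couplings and eventually in even `L`, `c · L⁴ · re tr P ≤ re tr (P Δ_d† Δ_d)` for the projection
`P` onto the sector ground eigenspace `E₀` of `hubbardTorus 2 L 1 U`. This file adds, sorry-free:

* `re_trace_projMatrix_mul_le` — the UPPER companion of `mul_re_trace_projMatrix_map_le`:
  `re ⟨v, A v⟩ ≤ C ‖v‖²` on `K` gives `re tr (P_K A) ≤ C · tr P_K` (column expansion
  `tr (P_K A) = Σ_i ⟨P_K e_i, A P_K e_i⟩`, `tr P_K = Σ_i ‖P_K e_i‖²`, no orthonormal frame needed);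
* `re_expect_pairField_conjTranspose_mul_le` — `‖Δ_g ψ‖² ≤ (C_g L²)² ‖ψ‖²` for EVERY Fock vector
  (`Δ_g` is a sum of `L²` local pair operators of norm `≤ C_g`);
* `re_trace_sectorGroundProj_mul_pairField_mem_Icc` — hence BOTH sides of the target's inequality
  are comparable numbers: `0 ≤ re tr (P Δ_g† Δ_g) ≤ (C_g L²)² · re tr P` for every sector, every
  Hamiltonian; the exponent `L⁴` is saturated at most and any admissible constant has `c ≤ C_d²`;
* `exists_groundState_seq_lro_of_birGroundStateAverageLRO` — the ∃-SEQUENCE SHADOW of the target: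
  if `BirGroundStateAverageLRO` holds with data `(δ, U₁, U₂, c)`, then for EVERY `U ∈ (U₁, U₂)`
  there is an all-sides admissible sequence of normalised `(2⌊(1-δ)L²/2⌋, S^z = 0)`-sector ground
  states of `hubbardTorus 2 L 1 U` with `d_{x²-y²}` pair-field long-range order along even sides,
  in the summit's own format `HasLongRangeOrder (fun k => halfOpenBox 2 (2k)) (torusPullback …)`.
  So the target already implies the summit's conclusion for SOME ground-state sequence at every
  coupling of its window; the summit asks it for EVERY sequence (at one coupling), which is what
  crux 5 (`BirEveryGroundState`, item 2083) must add.

Sources: D. J. Scalapino, Phys. Rep. 250 (1995) 329, §2 (pair field, eq. (2.4)); H. Tasaki,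
*Physics and Mathematics of Quantum Many-Body Systems* (2020) §2.1, App. A.2 (projections,
ground-state averages); S. Friedli, Y. Velenik, *Statistical Mechanics of Lattice Systems* (2017)
§3.7.2 (LRO as a `liminf`). Everything here is folklore; no definition is introduced.
-/

noncomputable section

namespace Summit.HubbardSuperconductivity.HubbardSuperconductivity.Theorems

open Matrix Finset Filter
open Literature.Probability.LatticeModels Literature.MathematicalPhysics.QuantumLattice
open Summit.HubbardSuperconductivity.HubbardSuperconductivity.Theses.BalabanIR
open scoped ComplexOrder

/-! ### Traces against a projection matrix: the column expansion and the upper bound -/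

section ProjTrace

variable {n : Type*} [Fintype n] [DecidableEq n]

omit [DecidableEq n] in
/-- `tr (Bᴴ A B) = Σ_i ⟨B e_i, A B e_i⟩`: the trace of a compression is the sum of the diagonal
matrix elements of `A` in the columns `Bᵀ i = B e_i` of `B`. [folklore] -/
theorem trace_conjTranspose_mul_mul_eq_sum (B A : Matrix n n ℂ) :
    (Bᴴ * A * B).trace = ∑ i, star (Bᵀ i) ⬝ᵥ (A *ᵥ Bᵀ i) := by
  simp only [Matrix.trace, Matrix.diag, Matrix.mul_apply, dotProduct, Matrix.mulVec,
    conjTranspose_apply, transpose_apply, Pi.star_apply, Finset.mul_sum, Finset.sum_mul]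
  refine Finset.sum_congr rfl fun i _ => ?_
  rw [Finset.sum_comm]
  refine Finset.sum_congr rfl fun j _ => Finset.sum_congr rfl fun k _ => ?_
  ring

/-- `tr (Bᴴ B) = Σ_i ‖B e_i‖²` (the case `A = 1`). [folklore] -/
theorem trace_conjTranspose_mul_self_eq_sum (B : Matrix n n ℂ) :
    (Bᴴ * B).trace = ∑ i, star (Bᵀ i) ⬝ᵥ Bᵀ i := by
  have h := trace_conjTranspose_mul_mul_eq_sum B 1
  simp only [Matrix.mul_one, Matrix.one_mulVec] at h
  exact h

/-- The columns of the projection matrix onto (the Euclidean transport of) `K ≤ (n → ℂ)` lie in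
`K` (`P e_i ∈ K`, `projMatrix_map_mulVec_mem`). [folklore] -/
theorem transpose_projMatrix_map_mem (K : Submodule ℂ (n → ℂ)) (i : n) :
    (projMatrix (K.map ((WithLp.linearEquiv 2 ℂ (n → ℂ)).symm :
      (n → ℂ) →ₗ[ℂ] EuclideanSpace ℂ n)))ᵀ i ∈ K := by
  have h := projMatrix_map_mulVec_mem K (Pi.single i 1)
  have hcol : projMatrix (K.map ((WithLp.linearEquiv 2 ℂ (n → ℂ)).symm :
      (n → ℂ) →ₗ[ℂ] EuclideanSpace ℂ n)) *ᵥ Pi.single i 1 =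
      (projMatrix (K.map ((WithLp.linearEquiv 2 ℂ (n → ℂ)).symm :
        (n → ℂ) →ₗ[ℂ] EuclideanSpace ℂ n)))ᵀ i := by
    funext k
    simp [Matrix.mulVec, dotProduct, Pi.single_apply, transpose_apply]
  rwa [hcol] at h

/-- `tr (P_K A) = tr (P_Kᴴ A P_K)` (`P_K` is a Hermitian idempotent; cyclicity). [folklore] -/
theorem trace_projMatrix_mul_eq (K : Submodule ℂ (EuclideanSpace ℂ n)) (A : Matrix n n ℂ) :
    (projMatrix K * A).trace = ((projMatrix K)ᴴ * A * projMatrix K).trace := by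
  rw [(projMatrix_isHermitian K).eq]
  conv_rhs => rw [trace_mul_comm, ← Matrix.mul_assoc, projMatrix_mul_self]

/-- `tr P_K = tr (P_Kᴴ P_K)`. [folklore] -/
theorem trace_projMatrix_eq (K : Submodule ℂ (EuclideanSpace ℂ n)) :
    (projMatrix K).trace = ((projMatrix K)ᴴ * projMatrix K).trace := by
  rw [(projMatrix_isHermitian K).eq, projMatrix_mul_self]

/-- **Average ≤ sup.** If `re ⟨v, A v⟩ ≤ C ‖v‖²` for every `v ∈ K`, then `re tr (P_K A) ≤ C · tr P_K`
for the projection matrix onto (the Euclidean transport of) `K`: expand both traces over the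
columns `P_K e_i ∈ K`. (Upper companion of `mul_re_trace_projMatrix_map_le`.)
Tasaki (2020) §2.1, App. A.2. [folklore] -/
theorem re_trace_projMatrix_mul_le (K : Submodule ℂ (n → ℂ)) (A : Matrix n n ℂ) (C : ℝ)
    (h : ∀ v ∈ K, (star v ⬝ᵥ A *ᵥ v).re ≤ C * (star v ⬝ᵥ v).re) :
    (projMatrix (K.map ((WithLp.linearEquiv 2 ℂ (n → ℂ)).symm :
        (n → ℂ) →ₗ[ℂ] EuclideanSpace ℂ n)) * A).trace.re ≤
      C * (projMatrix (K.map ((WithLp.linearEquiv 2 ℂ (n → ℂ)).symm :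
        (n → ℂ) →ₗ[ℂ] EuclideanSpace ℂ n))).trace.re := by
  rw [trace_projMatrix_mul_eq, trace_conjTranspose_mul_mul_eq_sum, trace_projMatrix_eq,
    trace_conjTranspose_mul_self_eq_sum, Complex.re_sum, Complex.re_sum, Finset.mul_sum]
  exact Finset.sum_le_sum fun i _ => h _ (transpose_projMatrix_map_mem K i)

/-- **Inf ≤ average (homogeneous form).** If `c ‖v‖² ≤ re ⟨v, A v⟩` for every `v ∈ K`, then
`c · tr P_K ≤ re tr (P_K A)` (same column expansion; compare the unit-vector form
`mul_re_trace_projMatrix_map_le`). Tasaki (2020) §2.1, App. A.2. [folklore] -/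
theorem mul_re_trace_projMatrix_le_of_forall_mem (K : Submodule ℂ (n → ℂ)) (A : Matrix n n ℂ)
    (c : ℝ) (h : ∀ v ∈ K, c * (star v ⬝ᵥ v).re ≤ (star v ⬝ᵥ A *ᵥ v).re) :
    c * (projMatrix (K.map ((WithLp.linearEquiv 2 ℂ (n → ℂ)).symm :
        (n → ℂ) →ₗ[ℂ] EuclideanSpace ℂ n))).trace.re ≤
      (projMatrix (K.map ((WithLp.linearEquiv 2 ℂ (n → ℂ)).symm :
        (n → ℂ) →ₗ[ℂ] EuclideanSpace ℂ n)) * A).trace.re := by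
  rw [trace_projMatrix_mul_eq, trace_conjTranspose_mul_mul_eq_sum, trace_projMatrix_eq,
    trace_conjTranspose_mul_self_eq_sum, Complex.re_sum, Complex.re_sum, Finset.mul_sum]
  exact Finset.sum_le_sum fun i _ => h _ (transpose_projMatrix_map_mem K i)

end ProjTrace

/-! ### The pair field is a bounded operator of norm `≤ C_g L²` -/

section PairFieldBound

/-- **`‖Δ_g ψ‖² ≤ (C_g L²)² ‖ψ‖²` for every Fock vector `ψ`**, with the crude constant
`C_g = Σ_{e ∈ {0} ∪ unitSteps} 2|g e|/√2`: `Δ_g = Σ_x P_x` is a sum of `L²` local pair operators,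
each a contraction up to `C_g` (`norm_toLp_localPair_mulVec_le`), and
`re ⟨ψ, Δ_g† Δ_g ψ⟩ = ‖Δ_g ψ‖²`. Scalapino, Phys. Rep. 250 (1995) 329, §2;
Bratteli–Robinson II §5.2.2. [folklore] -/
theorem re_expect_pairField_conjTranspose_mul_le (g : Site 2 → ℝ) (L : ℕ) [NeZero L]
    (ψ : Fock (Orb (FermionTorus 2 L))) :
    (star ψ ⬝ᵥ ((pairField g L)ᴴ * pairField g L) *ᵥ ψ).re ≤
      ((∑ e ∈ insert 0 unitSteps, ‖((g e / Real.sqrt 2 : ℝ) : ℂ)‖ * 2) * (L : ℝ) ^ 2) ^ 2 *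
        (star ψ ⬝ᵥ ψ).re := by
  set C : ℝ := ∑ e ∈ insert 0 unitSteps, ‖((g e / Real.sqrt 2 : ℝ) : ℂ)‖ * 2 with hC
  have hexp : star ψ ⬝ᵥ ((pairField g L)ᴴ * pairField g L) *ᵥ ψ =
      star (pairField g L *ᵥ ψ) ⬝ᵥ (pairField g L *ᵥ ψ) :=
    PosSemidefTrace.expect_conjTranspose_mul _ _ ψ
  rw [hexp, ← norm_toLp_sq_eq_re, ← norm_toLp_sq_eq_re]
  have hnorm : ‖(WithLp.toLp 2 (pairField g L *ᵥ ψ) :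
      EuclideanSpace ℂ (Finset (Orb (FermionTorus 2 L))))‖ ≤
      C * (L : ℝ) ^ 2 * ‖(WithLp.toLp 2 ψ : EuclideanSpace ℂ (Finset (Orb (FermionTorus 2 L))))‖ := by
    unfold pairField
    rw [Matrix.sum_mulVec, WithLp.toLp_sum]
    refine (norm_sum_le _ _).trans ?_
    calc ∑ x : TorusSite 2 L, ‖(WithLp.toLp 2 (localPair g L x *ᵥ ψ) :
            EuclideanSpace ℂ (Finset (Orb (FermionTorus 2 L))))‖
        ≤ ∑ _x : TorusSite 2 L,
            C * ‖(WithLp.toLp 2 ψ : EuclideanSpace ℂ (Finset (Orb (FermionTorus 2 L))))‖ :=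
          Finset.sum_le_sum fun x _ => norm_toLp_localPair_mulVec_le g L x ψ
      _ = C * (L : ℝ) ^ 2 *
            ‖(WithLp.toLp 2 ψ : EuclideanSpace ℂ (Finset (Orb (FermionTorus 2 L))))‖ := by
          rw [Finset.sum_const, Finset.card_univ, EnslavedA1g.card_torusSite_two, nsmul_eq_mul]
          push_cast
          ring
  have h0 : 0 ≤ ‖(WithLp.toLp 2 (pairField g L *ᵥ ψ) :
      EuclideanSpace ℂ (Finset (Orb (FermionTorus 2 L))))‖ := norm_nonneg _
  calc ‖(WithLp.toLp 2 (pairField g L *ᵥ ψ) :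
          EuclideanSpace ℂ (Finset (Orb (FermionTorus 2 L))))‖ ^ 2
      ≤ (C * (L : ℝ) ^ 2 *
          ‖(WithLp.toLp 2 ψ : EuclideanSpace ℂ (Finset (Orb (FermionTorus 2 L))))‖) ^ 2 :=
        pow_le_pow_left₀ h0 hnorm 2
    _ = (C * (L : ℝ) ^ 2) ^ 2 *
          ‖(WithLp.toLp 2 ψ : EuclideanSpace ℂ (Finset (Orb (FermionTorus 2 L))))‖ ^ 2 := by
        ring

/-- The Euclidean transport used in the route statements: `Fock.toEuclidean` IS the map
`(WithLp.linearEquiv 2 ℂ _).symm` along which the `projMatrix_map_*` lemmas are stated. [folklore] -/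
theorem map_toEuclidean_eq {ι : Type*} (K : Submodule ℂ (Fock ι)) :
    K.map (Fock.toEuclidean (ι := ι) : Fock ι →ₗ[ℂ] EuclideanSpace ℂ (Finset ι)) =
      K.map ((WithLp.linearEquiv 2 ℂ (Finset ι → ℂ)).symm :
        (Finset ι → ℂ) →ₗ[ℂ] EuclideanSpace ℂ (Finset ι)) := rfl

/-- **The two sides of the target's inequality are comparable:
`0 ≤ re tr (P Δ_g† Δ_g) ≤ (C_g L²)² · re tr P`** for the projection `P` onto the sector ground
eigenspace `E₀ = szSector N M ⊓ ker (H - e₀)` of ANY matrix `H` on the Fock space of the torus of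
side `L`, any sector `(N, M)` and any form factor `g` (`Δ_g† Δ_g ≥ 0`, and
`re_expect_pairField_conjTranspose_mul_le`). In `BirGroundStateAverageLRO` (`g = dWaveFormFactor`,
`re tr P ≥ 1` by `one_le_re_trace_groundProj_hubbardTorus`) the exponent `L⁴` is thus the largest
possible and any admissible constant satisfies `c ≤ C_d²`. Scalapino, Phys. Rep. 250 (1995) 329,
§2. [folklore] -/
theorem re_trace_sectorGroundProj_mul_pairField_mem_Icc (g : Site 2 → ℝ) (L : ℕ) [NeZero L]
    (H : Matrix (Finset (Orb (FermionTorus 2 L))) (Finset (Orb (FermionTorus 2 L))) ℂ)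
    (N : ℕ) (M : ℝ) :
    (projMatrix ((szSector N M ⊓ Module.End.eigenspace (Matrix.toLin' H)
        ((H.minEnergyOn (szSector N M) : ℝ) : ℂ)).map
        (Fock.toEuclidean (ι := Orb (FermionTorus 2 L)) :
          Fock (Orb (FermionTorus 2 L)) →ₗ[ℂ]
            EuclideanSpace ℂ (Finset (Orb (FermionTorus 2 L))))) *
        ((pairField g L)ᴴ * pairField g L)).trace.re ∈
      Set.Icc 0
        (((∑ e ∈ insert 0 unitSteps, ‖((g e / Real.sqrt 2 : ℝ) : ℂ)‖ * 2) * (L : ℝ) ^ 2) ^ 2 *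
          (projMatrix ((szSector N M ⊓ Module.End.eigenspace (Matrix.toLin' H)
            ((H.minEnergyOn (szSector N M) : ℝ) : ℂ)).map
            (Fock.toEuclidean (ι := Orb (FermionTorus 2 L)) :
              Fock (Orb (FermionTorus 2 L)) →ₗ[ℂ]
                EuclideanSpace ℂ (Finset (Orb (FermionTorus 2 L)))))).trace.re) := by
  rw [map_toEuclidean_eq]
  constructor
  · have h := mul_re_trace_projMatrix_le_of_forall_mem (szSector N M ⊓ Module.End.eigenspace
      (Matrix.toLin' H) ((H.minEnergyOn (szSector N M) : ℝ) : ℂ))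
      ((pairField g L)ᴴ * pairField g L) 0 (fun v _ => ?_)
    · rwa [zero_mul] at h
    · have hexp : star v ⬝ᵥ ((pairField g L)ᴴ * pairField g L) *ᵥ v =
          star (pairField g L *ᵥ v) ⬝ᵥ (pairField g L *ᵥ v) :=
        PosSemidefTrace.expect_conjTranspose_mul _ _ v
      rw [zero_mul, hexp, ← norm_toLp_sq_eq_re]
      positivity
  · exact re_trace_projMatrix_mul_le _ _ _
      fun v _ => re_expect_pairField_conjTranspose_mul_le g L v

end PairFieldBound

/-! ### The ∃-sequence shadow of the target -/

section Shadow

/-- **The target implies `d`-wave pair-field LRO of SOME admissible ground-state sequence, at every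
coupling of its window.** If `BirGroundStateAverageLRO` holds with data `(δ, U₁, U₂, c)`, then for
every `U ∈ (U₁, U₂)` there are `N L = 2⌊(1-δ)L²/2⌋` and normalised sector ground states `ψ_L` of
`hubbardTorus 2 L 1 U` at ALL sides `L` such that
`HasLongRangeOrder (fun k => halfOpenBox 2 (2k)) (fun k => torusPullback (pairFieldCorr d ψ) (2k))`
— the conclusion of the summit `HubbardSuperconductivity` for this particular sequence. Proof: at
the even sides `L ≥ L₀` take the ground state extracted from the average bound by
`exists_groundState_le_of_trace_bound` (`⟨Δ_d† Δ_d⟩ ≥ c L⁴`), elsewhere any normalised sector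
ground state (`NoGo.exists_unit_groundStateInSector_hubbardTorus`, also at side `0`); the LRO sequence along
`L = 2k` is then eventually `≥ c` (`torusLROSeq_pairFieldCorr_succ`) and always `≤ C_d²`
(`NoGo.pairFieldSeq_le`), so its `liminf` is `≥ c > 0`. The summit asks this for EVERY admissible
sequence at ONE coupling: the gap is exactly crux 5 (`BirEveryGroundState`).
Scalapino, Phys. Rep. 250 (1995) 329, §2 eq. (2.4); Friedli–Velenik (2017) §3.7.2. [folklore] -/
theorem exists_groundState_seq_lro_of_birGroundStateAverageLRO (h : BirGroundStateAverageLRO) :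
    ∃ δ ∈ Set.Ioo (0:ℝ) (1/2), ∃ U₁ U₂ : ℝ, 0 < U₁ ∧ U₁ < U₂ ∧ ∀ U ∈ Set.Ioo U₁ U₂,
      ∃ (N : ℕ → ℕ) (ψ : ∀ L, Fock (Orb (FermionTorus 2 L))),
        (∀ L, N L = 2 * ⌊(1 - δ) * (L : ℝ) ^ 2 / 2⌋₊ ∧ star (ψ L) ⬝ᵥ ψ L = 1 ∧
            IsGroundStateInSector (hubbardTorus 2 L 1 U) (N L) 0 (ψ L)) ∧
          HasLongRangeOrder (fun k => halfOpenBox 2 (2 * k))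
            (fun k => torusPullback (pairFieldCorr dWaveFormFactor ψ) (2 * k)) := by
  obtain ⟨δ, hδ, U₁, U₂, c, hU₁, hU₁₂, hc, hall⟩ := h
  refine ⟨δ, hδ, U₁, U₂, hU₁, hU₁₂, fun U hU => ?_⟩
  obtain ⟨L₀, hL₀⟩ := hall U hU
  have hδ' : (-1 : ℝ) ≤ δ := by linarith [hδ.1]
  -- positive sides: a normalised sector ground state, carrying the bound at the good even sides
  have key : ∀ m : ℕ, ∃ φ : Fock (Orb (FermionTorus 2 (m + 1))), star φ ⬝ᵥ φ = 1 ∧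
      IsGroundStateInSector (hubbardTorus 2 (m + 1) 1 U)
        (2 * ⌊(1 - δ) * ((m + 1 : ℕ) : ℝ) ^ 2 / 2⌋₊) 0 φ ∧
      (L₀ ≤ m + 1 → Even (m + 1) → c * ((m + 1 : ℕ) : ℝ) ^ 4 ≤
        (star φ ⬝ᵥ ((pairField dWaveFormFactor (m + 1))ᴴ * pairField dWaveFormFactor (m + 1)) *ᵥ
          φ).re) := by
    intro m
    by_cases hgood : L₀ ≤ m + 1 ∧ Even (m + 1)
    · obtain ⟨φ, hgs, hunit, hle⟩ :=
        exists_groundState_le_of_trace_bound (m + 1) 1 U δ c hδ' (hL₀ (m + 1) hgood.1 hgood.2)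
      exact ⟨φ, hunit, hgs, fun _ _ => hle⟩
    · obtain ⟨φ, hunit, hgs⟩ := NoGo.exists_unit_groundStateInSector_hubbardTorus (m + 1) 1 U
        (NoGo.floor_pairNumber_le δ hδ' (m + 1))
      exact ⟨φ, hunit, hgs, fun h₁ h₂ => absurd ⟨h₁, h₂⟩ hgood⟩
  choose φ hφ using key
  -- side `0`: any normalised sector ground state (the empty lattice; the value is never used)
  obtain ⟨φ₀, hφ₀, hφ₀'⟩ := NoGo.exists_unit_groundStateInSector_hubbardTorus 0 1 U
    (NoGo.floor_pairNumber_le δ hδ' 0)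
  let ψ : ∀ L, Fock (Orb (FermionTorus 2 L)) := fun L =>
    match L with
    | 0 => φ₀
    | m + 1 => φ m
  have hψ_succ : ∀ m, ψ (m + 1) = φ m := fun m => rfl
  refine ⟨fun L => 2 * ⌊(1 - δ) * (L : ℝ) ^ 2 / 2⌋₊, ψ, fun L => ?_, ?_⟩
  · cases L with
    | zero => exact ⟨rfl, hφ₀, hφ₀'⟩
    | succ m => exact ⟨rfl, (hφ m).1, (hφ m).2.1⟩
  -- long-range order along the even sides
  have hnorm : ∀ L, star (ψ L) ⬝ᵥ ψ L = 1 := fun L => by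
    cases L with
    | zero => exact hφ₀
    | succ m => exact (hφ m).1
  unfold HasLongRangeOrder
  have hup : ∀ k : ℕ, (∑ x ∈ halfOpenBox 2 (2 * k), ∑ y ∈ halfOpenBox 2 (2 * k),
      torusPullback (pairFieldCorr dWaveFormFactor ψ) (2 * k) x y) /
        ((halfOpenBox 2 (2 * k)).card : ℝ) ^ 2 ≤
      (∑ e ∈ insert 0 unitSteps, ‖((dWaveFormFactor e / Real.sqrt 2 : ℝ) : ℂ)‖ * 2) ^ 2 := by
    intro k
    cases k with
    | zero =>
      have h0 : ((halfOpenBox 2 (2 * 0)).card : ℝ) ^ 2 = 0 := by rw [card_halfOpenBox]; simp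
      rw [h0, div_zero]
      positivity
    | succ k =>
      obtain ⟨m, hm⟩ : ∃ m, 2 * (k + 1) = m + 1 := ⟨2 * k + 1, by ring⟩
      rw [hm, torusLROSeq_pairFieldCorr_succ]
      exact NoGo.pairFieldSeq_le dWaveFormFactor ψ hnorm m
  have hlow : ∀ᶠ k : ℕ in atTop, c ≤ (∑ x ∈ halfOpenBox 2 (2 * k), ∑ y ∈ halfOpenBox 2 (2 * k),
      torusPullback (pairFieldCorr dWaveFormFactor ψ) (2 * k) x y) /
        ((halfOpenBox 2 (2 * k)).card : ℝ) ^ 2 := by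
    refine eventually_atTop.2 ⟨L₀ + 1, fun k hk => ?_⟩
    obtain ⟨m, hm⟩ : ∃ m, 2 * k = m + 1 := ⟨2 * k - 1, by omega⟩
    have hb := (hφ m).2.2 (by omega) (by rw [← hm]; exact even_two_mul k)
    rw [hm, torusLROSeq_pairFieldCorr_succ, le_div_iff₀ (by positivity), hψ_succ]
    exact hb
  exact lt_of_lt_of_le hc
    (le_liminf_of_le (isCoboundedUnder_ge_of_eventually_le _ (Eventually.of_forall hup)) hlow)

end Shadow

end Summit.HubbardSuperconductivity.HubbardSuperconductivity.Theorems
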